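/-
Δ2 BRIDGE — RE-KEY (branch (c-S.1), T-SIGN = MIRROR): the KEYS of d2bridge-prove-7's ✔ `D2Bridge/OmegaPinAtLiuIndex.lean` (p371944) at the
index lines `LiuIndex.line V ρ μ₀ i`, re-typed over the μ-UNIFORM carriers of record at `δ′ = (2δ_L)⁻¹` and an ARBITRARY per-line TAIL
(`(Model.uniformOmegaRep … (2 * imagUnit L)⁻¹ (fun _ _ ↦ r)).rest t`, ✔ `Item6UniformOmegaRep.lean` p370765) through d2bridge-prove-4's
`Model.exists_omegaPin_line_tail` (`D2Bridge/OmegaPinAtDeltaPrimeTail.lean`), and over an ARBITRARY cut predicate `PhiMu : I V ρ μ₀ → Prop`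
(the landed file spells the cut `SplitLine.PhiMuLine ι₁ (line i)`; the re-keyed pin `Rekey.liuDictionaryPin` cuts at
`SplitLine.PhiMuLine ((starRingEnd ℂ).comp ι₁) (line i)`; the binder is only carried).  WHY: the re-keyed (d) row lives BY VALUE on the
`ῑ₁`-presented one-object tail `restTailOne (AlgHom.id ℚ L) ῑ₁ …` (d2bridge-prove-3's pieces head), the pin head reads ONE rest per line for
(a)(b)(c)(d), and p371944's `hR : restOfCharDeltaPrime … = R` pins the `ι₁`-presented tail; here `hR : U.rest (t …) = R …` for any tail (at the
`ι₁`-tail ✔ `Model.restOfCharRep_eq_rest`, `rfl`; at the `ῑ₁`-tail `rfl` against prove-3's head).  The per-line lemmas (k1)–(k4) are prove-7's,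
IMPORTED.  Seat prover-pub-hodgecm2-d2bridge-prove-4-g2-0.  THEOREMS ONLY; no definition, no named fact, no instance; the `variable` line carries
data binders only (`V ρ μ₀`, as in p371944); nothing landed is edited or restated beyond the re-typing.
HC_CM is NOT proved; «Δ2 BRIDGE CLOSED» is NOT claimed; hLiu = READING r8; no pointer moves.
-/
import Summits.HodgeConjecture.CorCM.D2Bridge.OmegaPinAtDeltaPrimeTail
import Summits.HodgeConjecture.CorCM.D2Bridge.OmegaPinAtLiuIndexOfRecord
import HarnessLib

/-!
# Ω-pin keys at the index lines, over any tail and any cut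

* `exists_pinTerms_line_tail` — ONE index line `i`: `σ ∕ hσ ∕ e ∕ he` at a section `r` through `u_a` (`hr`), a tail `t`, a rest `R` with
  `hR : (uniformOmegaRep … (fun _ _ ↦ r)).rest t = R`, and a key `(μ, hμ, hΦμ, hsEq)`;
* `exists_pinTerms_tail` — the binder shape `∀ (i) (hi : PhiMu i) (hg : Good i)` of `PinSignatures.thm418C_ofTower_of_pins` for ANY cut `PhiMu`,
  per-line tails `t i hi hg μ hμ hw`;
* `exists_pinTerms_update_tail` — the same at DECISION #9's sections `Rep.update Rep.ofLineOf (locF u_{a_i}) u_{a_i} rfl`;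
* `key_indexOfRecord_noCut`, `exists_pinTerms_indexOfRecord_tail` — at the index of record `(repAt a₀, muLiu ι₁ rep)` the key is pin-3's
  X3-Char theorem for EVERY continuous line (no cut hypothesis), so the Ω-slot is inhabited for ANY cut and ANY tails.

HC_CM is NOT proved.
-/

set_option autoImplicit false

noncomputable section

open scoped TensorProduct Matrix

namespace HodgeCM.Model.LiuIndex.OmegaPin

open NumberField NumberField.InfinitePlace IsDedekindDomain
open Literature.AlgebraicGeometry.Motives
open Literature.AlgebraicGeometry.ShimuraVarieties
open Literature.AlgebraicGeometry.ShimuraVarieties.UnitaryCanonicalModel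
open Literature.NumberTheory.Automorphic
open Literature.NumberTheory.Automorphic.IdeleClassGroup
open Literature.NumberTheory.Automorphic.Liu2021
open Literature.NumberTheory.Automorphic.Liu2021.AppendixC
open Literature.NumberTheory.Automorphic.Liu2021.Def411WeilCarriers (JW TW locF Rep Eps)
open Literature.NumberTheory.Automorphic.Liu2021.Def411WeilCarriersDoubling
open Literature.NumberTheory.GelbartRogawski1991 Literature.NumberTheory.GelbartRogawski1991.UnitaryDualPair
open Summit.HodgeConjecture.CorCM
open Summit.HodgeConjecture.CorCM.Transposition.OmegaTransport (realUnit JW_realUnit TW_realUnit)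
open Summit.HodgeConjecture.CorCM.Transposition.CentralTypeAtPin (exists_weightOne_line_s_eq_chiSplittingLine_toHeckeCharacter)
open Literature.RepresentationTheory.Liu2021 (isOscillatorChar_toHeckeCharacter_iff)
open HodgeCM.Model.ArchSideTerm (e₁)

variable {L : HodgeCM.CMField} {ι₁ : (L : Type) →+* ℂ} (V : HodgeCM.HermSpace3 L ι₁)
  (ρ : GramClass L → RealScalar L) (μ₀ : GramClass L → InfinitePlace (L : Type) → ℤ)
/-! ## The Ω-slot per line and in the binder shape of the S∞ theorems, over any tail — THEOREMS ONLY -/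

section PerLine

set_option maxHeartbeats 2000000 in
/-- **THE Ω-SLOT OF ONE INDEX LINE `i`, OVER ANY TAIL `t`** — `σ ∕ hσ ∕ e ∕ he` EXIST at a section `r` through `u_a` (`hr`), a rest `R`
identified with the uniform δ′ rest `U.rest t` (`hR`) and a key `(μ, hμ, hΦμ, hsEq)`: `Model.exists_omegaPin_line_tail` at `p := line i` with the keys turned — `ε := locF u_a`, the
orientation (k2+k3), `T_W ∕ J_W` (k2), the line's own splitting `(line i).s ∕ .hs` with `hsEq` (X3-Char item (E)), `Adm := {χ ∕∕ (line i).IsAutChar χ}`,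
`χof := (·.1)` (k1).  (The witness `σ`'s `Eps`-label is `locF u_a` = the δ′-collection of the printed Def. 4.12 label `u_a·(2δ_L)⁻¹`; that
label identity lives inside the witness and is NOT exported through the ∃.)
[cite: Liu2021, Def. 4.11 (FJcycle.tex l. 2088–2096), Def. 4.12 (l. 2102–2108), Thm. 4.18 (l. 2232–2237), App. D §D.1 Steps 1–3 (l. 5215–5221)]
[cite: GelbartRogawski1991, §3.1 Prop. 3.1.1 p. 455 L1–3, Remark p. 457 L4–13] -/
theorem exists_pinTerms_line_tail
    (ιV : ↥V.adelicFin →*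
      ↥(UnitaryGroup.finAdelic (↥(maximalRealSubfield (L : Type))) (L : Type) (IsCMField.complexConj (L : Type)) 3
        (Matrix.diagonal (frameD V))))
    (h : exists_recordSystem) [IsGalois ℚ (L : Type)] (Φ : CMType (L : Type))
    (i : I V ρ μ₀) (r : Rep ↥(maximalRealSubfield (L : Type)) (imagUnitSq (L : Type)))
    (hr : r.toFun (locF ↥(maximalRealSubfield (L : Type)) (imagUnitSq (L : Type)) (realUnit ⟨L.K⟩ (ρ i.1).1 (ρ i.1).2.1 (ρ i.1).2.2)) =
      realUnit ⟨L.K⟩ (ρ i.1).1 (ρ i.1).2.1 (ρ i.1).2.2)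
    (μ : Literature.NumberTheory.Automorphic.IdeleClassGroup (L : Type) →ₜ* Circle) (hμ : IsConjugateSymplectic (L : Type) μ)
    (t : RestTail (Model.sec42DataOf h Model.isoOf ⟨L.K⟩ ι₁ ⟨V.Hm, V.isHermitian, V.signature_ι₁, V.posDef_of_ne⟩ Φ) μ hμ)
    (R : Thm418Rest (Model.sec42DataOf h Model.isoOf ⟨L.K⟩ ι₁ ⟨V.Hm, V.isHermitian, V.signature_ι₁, V.posDef_of_ne⟩ Φ))
    (hR : (Model.uniformOmegaRep h ⟨L.K⟩ ι₁ ⟨V.Hm, V.isHermitian, V.signature_ι₁, V.posDef_of_ne⟩ Φ e₁ (frameD V) (frameD_real V)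
      (frameD_ne V) ιV (2 * imagUnit (L : Type))⁻¹ (fun _ _ => r)).rest t = R)
    (hΦμ : HasCMType (L : Type) μ (line V ρ μ₀ i).lineType)
    (hsEq : (line V ρ μ₀ i).s =
      chiSplittingLine (L : Type) e₁ (frameD V) (frameD_real V) (frameD_ne V) (toHeckeCharacter (L : Type) μ)
        (isUnitary_toHeckeCharacter (L : Type) μ) ((isOscillatorChar_toHeckeCharacter_iff μ).mpr hμ)
        (line V ρ μ₀ i).TW (line V ρ μ₀ i).hWd (line V ρ μ₀ i).JW (line V ρ μ₀ i).hJW) :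
    ∃ (σ : {χ : (line V ρ μ₀ i).CharW // (line V ρ μ₀ i).IsAutChar χ} → (toThm418Data _ R).AdmIndex) (_ : Function.Injective σ)
      (e : ∀ a : {χ : (line V ρ μ₀ i).CharW // (line V ρ μ₀ i).IsAutChar χ}, (line V ρ μ₀ i).Ω ιV a.1 ≃ₗ[ℂ] (toThm418Data _ R).omegaAt (σ a)),
      ∀ (a : {χ : (line V ρ μ₀ i).CharW // (line V ρ μ₀ i).IsAutChar χ}) (g : ↥V.adelicFin) (m : (line V ρ μ₀ i).Ω ιV a.1),
        e a (MonoidAlgebra.of ℂ ↥V.adelicFin g • m) = (toThm418Data _ R).rhoAt (σ a) g (e a m) :=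
  Model.exists_omegaPin_line_tail h ⟨L.K⟩ ι₁ ⟨V.Hm, V.isHermitian, V.signature_ι₁, V.posDef_of_ne⟩ Φ e₁ (frameD V) (frameD_real V)
    (frameD_ne V) ιV r μ hμ t R hR
    (locF ↥(maximalRealSubfield (L : Type)) (imagUnitSq (L : Type)) (realUnit ⟨L.K⟩ (ρ i.1).1 (ρ i.1).2.1 (ρ i.1).2.2))
    ⟨realUnit ⟨L.K⟩ (ρ i.1).1 (ρ i.1).2.1 (ρ i.1).2.2, rfl⟩ (deltaPos_rep_of_hasCMType_line V ρ μ₀ i r hr hμ hΦμ)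
    (line V ρ μ₀ i).TW (line V ρ μ₀ i).JW (line V ρ μ₀ i).hW (line V ρ μ₀ i).hWd (line V ρ μ₀ i).hJW
    (TW_rep_line V ρ μ₀ i r hr) (JW_rep_line V ρ μ₀ i r hr) (line V ρ μ₀ i).s (line V ρ μ₀ i).hs hsEq
    (fun a : {χ : (line V ρ μ₀ i).CharW // (line V ρ μ₀ i).IsAutChar χ} => a.1)
    (fun a => isOpen_ker_and_rational_of_isAutChar V ρ μ₀ i a.1 a.2) Subtype.val_injective

end PerLine

section Packaging

/-- **THE Ω-SLOT OF THE PINNED DICTIONARY, PACKAGED, OVER PER-LINE TAILS AND ANY CUT** in the binder shape `∀ (i) (hi : PhiMu i) (hg : Good i)` of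
`PinSignatures.thm418C_ofTower_of_pins` (`PhiMu := PhiMuLine ι₁ ∘ line` at the landed pin, `PhiMuLine ῑ₁ ∘ line` at the re-keyed pin): for any goodness predicate with a KEY at every good line — a conjugate-symplectic weight-one `μ` with
`Φ_μ = (line i).lineType` and `(line i).s = ι_{toHecke μ}` (at the index of record: pin-3's X3-Char theorem for the continuous lines) —
sections `r i hi hg` through the lines of record (`hr`) and rests `R i hi hg μ hμ hw` identified with the uniform δ′ rests over the tails `t i hi hg μ hμ hw` (`hR`), there are families
`μ ∕ hμ ∕ hw` and `σ ∕ e` over `R i hi hg (μ i hi hg) …` with `hσ`, `he` and the CM-type identity (`hadm` seam).  `exists_pinTerms_line_tail` at every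
good line; `Classical.choice` inside the proof only.  HC_CM is NOT proved; «Δ2 BRIDGE CLOSED» is NOT claimed.
[cite: Liu2021, Thm. 4.18 (FJcycle.tex l. 2232–2237), Def. 4.11 (l. 2088–2096), Def. 4.12 (l. 2102–2108), App. D §D.1 Steps 1–3 (l. 5215–5221)]
[cite: GelbartRogawski1991, §3.1 Prop. 3.1.1 p. 455 L1–3] -/
theorem exists_pinTerms_tail
    (ιV : ↥V.adelicFin →*
      ↥(UnitaryGroup.finAdelic (↥(maximalRealSubfield (L : Type))) (L : Type) (IsCMField.complexConj (L : Type)) 3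
        (Matrix.diagonal (frameD V))))
    (h : exists_recordSystem) [IsGalois ℚ (L : Type)] (Φ : CMType (L : Type))
    (PhiMu Good : I V ρ μ₀ → Prop)
    (key : ∀ i : I V ρ μ₀, PhiMu i → Good i →
      ∃ (μ : Literature.NumberTheory.Automorphic.IdeleClassGroup (L : Type) →ₜ* Circle) (hμ : IsConjugateSymplectic (L : Type) μ),
        HasWeight (L : Type) μ 1 ∧ HasCMType (L : Type) μ (line V ρ μ₀ i).lineType ∧
          (line V ρ μ₀ i).s =
            chiSplittingLine (L : Type) e₁ (frameD V) (frameD_real V) (frameD_ne V) (toHeckeCharacter (L : Type) μ)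
              (isUnitary_toHeckeCharacter (L : Type) μ) ((isOscillatorChar_toHeckeCharacter_iff μ).mpr hμ)
              (realDiagonal (L : Type) (RealScalar.vec (ρ i.1)) (RealScalar.vec_real (ρ i.1)))
              (isUnit_det_realDiagonal (L : Type) (RealScalar.vec (ρ i.1)) (RealScalar.vec_real (ρ i.1)) (RealScalar.vec_ne (ρ i.1)))
              (Matrix.diagonal (RealScalar.vec (ρ i.1)))
              (realDiagonal_map (L : Type) (RealScalar.vec (ρ i.1)) (RealScalar.vec_real (ρ i.1))).symm)
    (r : ∀ i : I V ρ μ₀, PhiMu i → Good i → Rep ↥(maximalRealSubfield (L : Type)) (imagUnitSq (L : Type)))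
    (hr : ∀ (i : I V ρ μ₀) (hi : PhiMu i) (hg : Good i),
      (r i hi hg).toFun (locF ↥(maximalRealSubfield (L : Type)) (imagUnitSq (L : Type)) (realUnit ⟨L.K⟩ (ρ i.1).1 (ρ i.1).2.1 (ρ i.1).2.2)) =
        realUnit ⟨L.K⟩ (ρ i.1).1 (ρ i.1).2.1 (ρ i.1).2.2)
    (t : ∀ (i : I V ρ μ₀) (_ : PhiMu i) (_ : Good i)
      (μ : Literature.NumberTheory.Automorphic.IdeleClassGroup (L : Type) →ₜ* Circle) (hμ : IsConjugateSymplectic (L : Type) μ)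
      (_ : HasWeight (L : Type) μ 1),
      RestTail (Model.sec42DataOf h Model.isoOf ⟨L.K⟩ ι₁ ⟨V.Hm, V.isHermitian, V.signature_ι₁, V.posDef_of_ne⟩ Φ) μ hμ)
    (R : ∀ (i : I V ρ μ₀) (_ : PhiMu i) (_ : Good i)
      (μ : Literature.NumberTheory.Automorphic.IdeleClassGroup (L : Type) →ₜ* Circle) (_ : IsConjugateSymplectic (L : Type) μ)
      (_ : HasWeight (L : Type) μ 1),
      Thm418Rest (Model.sec42DataOf h Model.isoOf ⟨L.K⟩ ι₁ ⟨V.Hm, V.isHermitian, V.signature_ι₁, V.posDef_of_ne⟩ Φ))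
    (hR : ∀ (i : I V ρ μ₀) (hi : PhiMu i) (hg : Good i)
      (μ : Literature.NumberTheory.Automorphic.IdeleClassGroup (L : Type) →ₜ* Circle) (hμ : IsConjugateSymplectic (L : Type) μ)
      (hw : HasWeight (L : Type) μ 1),
      (Model.uniformOmegaRep h ⟨L.K⟩ ι₁ ⟨V.Hm, V.isHermitian, V.signature_ι₁, V.posDef_of_ne⟩ Φ e₁ (frameD V) (frameD_real V)
        (frameD_ne V) ιV (2 * imagUnit (L : Type))⁻¹ (fun _ _ => r i hi hg)).rest (t i hi hg μ hμ hw) = R i hi hg μ hμ hw) :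
    ∃ (μ : ∀ i : I V ρ μ₀, PhiMu i → Good i →
        (Literature.NumberTheory.Automorphic.IdeleClassGroup (L : Type) →ₜ* Circle))
      (hμ : ∀ (i : I V ρ μ₀) (hi : PhiMu i) (hg : Good i), IsConjugateSymplectic (L : Type) (μ i hi hg))
      (hw : ∀ (i : I V ρ μ₀) (hi : PhiMu i) (hg : Good i), HasWeight (L : Type) (μ i hi hg) 1)
      (σ : ∀ (i : I V ρ μ₀) (hi : PhiMu i) (hg : Good i),
        {χ : (line V ρ μ₀ i).CharW // (line V ρ μ₀ i).IsAutChar χ} →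
          (toThm418Data _ (R i hi hg (μ i hi hg) (hμ i hi hg) (hw i hi hg))).AdmIndex)
      (e : ∀ (i : I V ρ μ₀) (hi : PhiMu i) (hg : Good i)
        (a : {χ : (line V ρ μ₀ i).CharW // (line V ρ μ₀ i).IsAutChar χ}),
        (line V ρ μ₀ i).Ω ιV a.1 ≃ₗ[ℂ] (toThm418Data _ (R i hi hg (μ i hi hg) (hμ i hi hg) (hw i hi hg))).omegaAt (σ i hi hg a)),
      (∀ (i : I V ρ μ₀) (hi : PhiMu i) (hg : Good i),
          HasCMType (L : Type) (μ i hi hg) (line V ρ μ₀ i).lineType) ∧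
      (∀ (i : I V ρ μ₀) (hi : PhiMu i) (hg : Good i), Function.Injective (σ i hi hg)) ∧
      (∀ (i : I V ρ μ₀) (hi : PhiMu i) (hg : Good i)
          (a : {χ : (line V ρ μ₀ i).CharW // (line V ρ μ₀ i).IsAutChar χ}) (g : ↥V.adelicFin) (m : (line V ρ μ₀ i).Ω ιV a.1),
          e i hi hg a (MonoidAlgebra.of ℂ ↥V.adelicFin g • m) =
            (toThm418Data _ (R i hi hg (μ i hi hg) (hμ i hi hg) (hw i hi hg))).rhoAt (σ i hi hg a) g (e i hi hg a m)) := by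
  choose μ hμ hw hΦ hs using key
  have H := fun (i : I V ρ μ₀) (hi : PhiMu i) (hg : Good i) =>
    exists_pinTerms_line_tail V ρ μ₀ ιV h Φ i (r i hi hg) (hr i hi hg) (μ i hi hg) (hμ i hi hg) _ _
      (hR i hi hg (μ i hi hg) (hμ i hi hg) (hw i hi hg)) (hΦ i hi hg)
      ((line_s_eq_chiSplittingLine_iff V ρ μ₀ i (μ i hi hg) (hμ i hi hg)).1 (hs i hi hg))
  choose σ hσ e he using H
  exact ⟨μ, hμ, hw, σ, e, hΦ, hσ, he⟩

/-- **THE Ω-SLOT AT DECISION #9's SECTIONS** `r i := Rep.update Rep.ofLineOf (locF u_{a_i}) u_{a_i} rfl` (= F5's `repOfLine a_i`):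
`exists_pinTerms_tail` with `hr := Rep.update_toFun_self`; the identified rests are then the composition's per-line `(U i hi hg).rest (tail …)` at
the constant section, by `hR`. [cite: Liu2021, Thm. 4.18 (FJcycle.tex l. 2232–2237), Def. 4.12 (l. 2102–2108)] -/
theorem exists_pinTerms_update_tail
    (ιV : ↥V.adelicFin →*
      ↥(UnitaryGroup.finAdelic (↥(maximalRealSubfield (L : Type))) (L : Type) (IsCMField.complexConj (L : Type)) 3
        (Matrix.diagonal (frameD V))))
    (h : exists_recordSystem) [IsGalois ℚ (L : Type)] (Φ : CMType (L : Type))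
    (PhiMu Good : I V ρ μ₀ → Prop)
    (key : ∀ i : I V ρ μ₀, PhiMu i → Good i →
      ∃ (μ : Literature.NumberTheory.Automorphic.IdeleClassGroup (L : Type) →ₜ* Circle) (hμ : IsConjugateSymplectic (L : Type) μ),
        HasWeight (L : Type) μ 1 ∧ HasCMType (L : Type) μ (line V ρ μ₀ i).lineType ∧
          (line V ρ μ₀ i).s =
            chiSplittingLine (L : Type) e₁ (frameD V) (frameD_real V) (frameD_ne V) (toHeckeCharacter (L : Type) μ)
              (isUnitary_toHeckeCharacter (L : Type) μ) ((isOscillatorChar_toHeckeCharacter_iff μ).mpr hμ)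
              (realDiagonal (L : Type) (RealScalar.vec (ρ i.1)) (RealScalar.vec_real (ρ i.1)))
              (isUnit_det_realDiagonal (L : Type) (RealScalar.vec (ρ i.1)) (RealScalar.vec_real (ρ i.1)) (RealScalar.vec_ne (ρ i.1)))
              (Matrix.diagonal (RealScalar.vec (ρ i.1)))
              (realDiagonal_map (L : Type) (RealScalar.vec (ρ i.1)) (RealScalar.vec_real (ρ i.1))).symm)
    (t : ∀ (i : I V ρ μ₀) (_ : PhiMu i) (_ : Good i)
      (μ : Literature.NumberTheory.Automorphic.IdeleClassGroup (L : Type) →ₜ* Circle) (hμ : IsConjugateSymplectic (L : Type) μ)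
      (_ : HasWeight (L : Type) μ 1),
      RestTail (Model.sec42DataOf h Model.isoOf ⟨L.K⟩ ι₁ ⟨V.Hm, V.isHermitian, V.signature_ι₁, V.posDef_of_ne⟩ Φ) μ hμ)
    (R : ∀ (i : I V ρ μ₀) (_ : PhiMu i) (_ : Good i)
      (μ : Literature.NumberTheory.Automorphic.IdeleClassGroup (L : Type) →ₜ* Circle) (_ : IsConjugateSymplectic (L : Type) μ)
      (_ : HasWeight (L : Type) μ 1),
      Thm418Rest (Model.sec42DataOf h Model.isoOf ⟨L.K⟩ ι₁ ⟨V.Hm, V.isHermitian, V.signature_ι₁, V.posDef_of_ne⟩ Φ))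
    (hR : ∀ (i : I V ρ μ₀) (hi : PhiMu i) (hg : Good i)
      (μ : Literature.NumberTheory.Automorphic.IdeleClassGroup (L : Type) →ₜ* Circle) (hμ : IsConjugateSymplectic (L : Type) μ)
      (hw : HasWeight (L : Type) μ 1),
      (Model.uniformOmegaRep h ⟨L.K⟩ ι₁ ⟨V.Hm, V.isHermitian, V.signature_ι₁, V.posDef_of_ne⟩ Φ e₁ (frameD V) (frameD_real V)
        (frameD_ne V) ιV (2 * imagUnit (L : Type))⁻¹
        (fun _ _ => Rep.update ↥(maximalRealSubfield (L : Type)) (imagUnitSq (L : Type))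
          (Rep.ofLineOf ↥(maximalRealSubfield (L : Type)) (imagUnitSq (L : Type)))
          (locF ↥(maximalRealSubfield (L : Type)) (imagUnitSq (L : Type)) (realUnit ⟨L.K⟩ (ρ i.1).1 (ρ i.1).2.1 (ρ i.1).2.2))
          (realUnit ⟨L.K⟩ (ρ i.1).1 (ρ i.1).2.1 (ρ i.1).2.2) rfl)).rest (t i hi hg μ hμ hw) = R i hi hg μ hμ hw) :
    ∃ (μ : ∀ i : I V ρ μ₀, PhiMu i → Good i →
        (Literature.NumberTheory.Automorphic.IdeleClassGroup (L : Type) →ₜ* Circle))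
      (hμ : ∀ (i : I V ρ μ₀) (hi : PhiMu i) (hg : Good i), IsConjugateSymplectic (L : Type) (μ i hi hg))
      (hw : ∀ (i : I V ρ μ₀) (hi : PhiMu i) (hg : Good i), HasWeight (L : Type) (μ i hi hg) 1)
      (σ : ∀ (i : I V ρ μ₀) (hi : PhiMu i) (hg : Good i),
        {χ : (line V ρ μ₀ i).CharW // (line V ρ μ₀ i).IsAutChar χ} →
          (toThm418Data _ (R i hi hg (μ i hi hg) (hμ i hi hg) (hw i hi hg))).AdmIndex)
      (e : ∀ (i : I V ρ μ₀) (hi : PhiMu i) (hg : Good i)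
        (a : {χ : (line V ρ μ₀ i).CharW // (line V ρ μ₀ i).IsAutChar χ}),
        (line V ρ μ₀ i).Ω ιV a.1 ≃ₗ[ℂ] (toThm418Data _ (R i hi hg (μ i hi hg) (hμ i hi hg) (hw i hi hg))).omegaAt (σ i hi hg a)),
      (∀ (i : I V ρ μ₀) (hi : PhiMu i) (hg : Good i),
          HasCMType (L : Type) (μ i hi hg) (line V ρ μ₀ i).lineType) ∧
      (∀ (i : I V ρ μ₀) (hi : PhiMu i) (hg : Good i), Function.Injective (σ i hi hg)) ∧
      (∀ (i : I V ρ μ₀) (hi : PhiMu i) (hg : Good i)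
          (a : {χ : (line V ρ μ₀ i).CharW // (line V ρ μ₀ i).IsAutChar χ}) (g : ↥V.adelicFin) (m : (line V ρ μ₀ i).Ω ιV a.1),
          e i hi hg a (MonoidAlgebra.of ℂ ↥V.adelicFin g • m) =
            (toThm418Data _ (R i hi hg (μ i hi hg) (hμ i hi hg) (hw i hi hg))).rhoAt (σ i hi hg a) g (e i hi hg a m)) :=
  exists_pinTerms_tail V ρ μ₀ ιV h Φ PhiMu Good key
    (fun i _ _ => Rep.update ↥(maximalRealSubfield (L : Type)) (imagUnitSq (L : Type))
      (Rep.ofLineOf ↥(maximalRealSubfield (L : Type)) (imagUnitSq (L : Type)))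
      (locF ↥(maximalRealSubfield (L : Type)) (imagUnitSq (L : Type)) (realUnit ⟨L.K⟩ (ρ i.1).1 (ρ i.1).2.1 (ρ i.1).2.2))
      (realUnit ⟨L.K⟩ (ρ i.1).1 (ρ i.1).2.1 (ρ i.1).2.2) rfl)
    (fun i _ _ => update_toFun_line V ρ μ₀ i) t R hR

end Packaging

/-! ## At the index of record `(repAt a₀, muLiu ι₁ GramClass.rep)` — the key needs no cut -/

section OfRecord

variable (a₀ : RealScalar L)

/-- **THE KEY OF RECORD, CUT-FREE** — prove-7's `key_indexOfRecord` without its (unused) `PhiMuLine ι₁` binder: under `hemb`, every CONTINUOUS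
index line `i` has a conjugate-symplectic weight-one `μ` with `Φ_μ = (line i).lineType` and `(line i).s = ι_{toHecke μ}` (pin-3's X3-Char theorem
`exists_weightOne_line_s_eq_chiSplittingLine_toHeckeCharacter`).  [cite: Liu2021, Def. 4.12 (FJcycle.tex l. 2102–2108), Prop. 4.13 (l. 2113–2119), App. D §D.1 Step 2 (l. 5219)] -/
theorem key_indexOfRecord_noCut (hemb : (InfinitePlace.mk ι₁).embedding = ι₁) (i : I V (repAt a₀) (muLiu ι₁ GramClass.rep))
    (hg : Continuous (i.2.1 : SplittingAt V (repAt a₀ i.1))) :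
    ∃ (μ : Literature.NumberTheory.Automorphic.IdeleClassGroup (L : Type) →ₜ* Circle) (hμ : IsConjugateSymplectic (L : Type) μ),
      HasWeight (L : Type) μ 1 ∧ HasCMType (L : Type) μ (line V (repAt a₀) (muLiu ι₁ GramClass.rep) i).lineType ∧
        (line V (repAt a₀) (muLiu ι₁ GramClass.rep) i).s =
          chiSplittingLine (L : Type) e₁ (frameD V) (frameD_real V) (frameD_ne V) (toHeckeCharacter (L : Type) μ)
            (isUnitary_toHeckeCharacter (L : Type) μ) ((isOscillatorChar_toHeckeCharacter_iff μ).mpr hμ)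
            (realDiagonal (L : Type) (RealScalar.vec (repAt a₀ i.1)) (RealScalar.vec_real (repAt a₀ i.1)))
            (isUnit_det_realDiagonal (L : Type) (RealScalar.vec (repAt a₀ i.1)) (RealScalar.vec_real (repAt a₀ i.1))
              (RealScalar.vec_ne (repAt a₀ i.1)))
            (Matrix.diagonal (RealScalar.vec (repAt a₀ i.1)))
            (realDiagonal_map (L : Type) (RealScalar.vec (repAt a₀ i.1)) (RealScalar.vec_real (repAt a₀ i.1))).symm :=
  exists_weightOne_line_s_eq_chiSplittingLine_toHeckeCharacter V (repAt a₀) GramClass.rep (fun q => repAt_spec a₀ q)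
    GramClass.mk_rep hemb i hg

/-- **THE Ω-SLOT AT THE INDEX OF RECORD, INHABITED FOR ANY CUT `PhiMu` AND ANY TAILS** (`Good i := Continuous i.2.1`, sections
`Rep.update Rep.ofLineOf (locF u_{a_i}) u_{a_i} rfl`, rests identified by `hR` with the uniform δ′ rests over the tails `t …`): prove-7's
`exists_pinTerms_indexOfRecord` with the cut and the tail generalised — binder group (b) of `PinSignatures.thm418C_ofTower_of_pins` at the landed
pin (`PhiMu := PhiMuLine ι₁ ∘ line`, ι₁-tails) AND at the re-keyed pin (`PhiMu := PhiMuLine ῑ₁ ∘ line`, ῑ₁- or ι₁-tails).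
[cite: Liu2021, Thm. 4.18 (FJcycle.tex l. 2232–2237), Def. 4.11 (l. 2088–2096), Def. 4.12 (l. 2102–2108), Prop. 4.13 (l. 2113–2119), App. D §D.1 Steps 1–3 (l. 5215–5221)]
[cite: GelbartRogawski1991, §3.1 Prop. 3.1.1 p. 455 L1–3] -/
theorem exists_pinTerms_indexOfRecord_tail
    (ιV : ↥V.adelicFin →*
      ↥(UnitaryGroup.finAdelic (↥(maximalRealSubfield (L : Type))) (L : Type) (IsCMField.complexConj (L : Type)) 3
        (Matrix.diagonal (frameD V))))
    (h : exists_recordSystem) [IsGalois ℚ (L : Type)] (Φ : CMType (L : Type))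
    (hemb : (InfinitePlace.mk ι₁).embedding = ι₁) (PhiMu : I V (repAt a₀) (muLiu ι₁ GramClass.rep) → Prop)
    (t : ∀ (i : I V (repAt a₀) (muLiu ι₁ GramClass.rep)) (_ : PhiMu i) (_ : Continuous (i.2.1 : SplittingAt V (repAt a₀ i.1)))
      (μ : Literature.NumberTheory.Automorphic.IdeleClassGroup (L : Type) →ₜ* Circle) (hμ : IsConjugateSymplectic (L : Type) μ)
      (_ : HasWeight (L : Type) μ 1),
      RestTail (Model.sec42DataOf h Model.isoOf ⟨L.K⟩ ι₁ ⟨V.Hm, V.isHermitian, V.signature_ι₁, V.posDef_of_ne⟩ Φ) μ hμ)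
    (R : ∀ (i : I V (repAt a₀) (muLiu ι₁ GramClass.rep)) (_ : PhiMu i) (_ : Continuous (i.2.1 : SplittingAt V (repAt a₀ i.1)))
      (μ : Literature.NumberTheory.Automorphic.IdeleClassGroup (L : Type) →ₜ* Circle) (_ : IsConjugateSymplectic (L : Type) μ)
      (_ : HasWeight (L : Type) μ 1),
      Thm418Rest (Model.sec42DataOf h Model.isoOf ⟨L.K⟩ ι₁ ⟨V.Hm, V.isHermitian, V.signature_ι₁, V.posDef_of_ne⟩ Φ))
    (hR : ∀ (i : I V (repAt a₀) (muLiu ι₁ GramClass.rep)) (hi : PhiMu i) (hg : Continuous (i.2.1 : SplittingAt V (repAt a₀ i.1)))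
      (μ : Literature.NumberTheory.Automorphic.IdeleClassGroup (L : Type) →ₜ* Circle) (hμ : IsConjugateSymplectic (L : Type) μ)
      (hw : HasWeight (L : Type) μ 1),
      (Model.uniformOmegaRep h ⟨L.K⟩ ι₁ ⟨V.Hm, V.isHermitian, V.signature_ι₁, V.posDef_of_ne⟩ Φ e₁ (frameD V) (frameD_real V)
        (frameD_ne V) ιV (2 * imagUnit (L : Type))⁻¹
        (fun _ _ => Rep.update ↥(maximalRealSubfield (L : Type)) (imagUnitSq (L : Type))
          (Rep.ofLineOf ↥(maximalRealSubfield (L : Type)) (imagUnitSq (L : Type)))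
          (locF ↥(maximalRealSubfield (L : Type)) (imagUnitSq (L : Type))
            (realUnit ⟨L.K⟩ (repAt a₀ i.1).1 (repAt a₀ i.1).2.1 (repAt a₀ i.1).2.2))
          (realUnit ⟨L.K⟩ (repAt a₀ i.1).1 (repAt a₀ i.1).2.1 (repAt a₀ i.1).2.2) rfl)).rest (t i hi hg μ hμ hw) = R i hi hg μ hμ hw) :
    ∃ (μ : ∀ i : I V (repAt a₀) (muLiu ι₁ GramClass.rep),
        PhiMu i → Continuous (i.2.1 : SplittingAt V (repAt a₀ i.1)) →
          (Literature.NumberTheory.Automorphic.IdeleClassGroup (L : Type) →ₜ* Circle))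
      (hμ : ∀ (i : I V (repAt a₀) (muLiu ι₁ GramClass.rep)) (hi : PhiMu i)
        (hg : Continuous (i.2.1 : SplittingAt V (repAt a₀ i.1))), IsConjugateSymplectic (L : Type) (μ i hi hg))
      (hw : ∀ (i : I V (repAt a₀) (muLiu ι₁ GramClass.rep)) (hi : PhiMu i)
        (hg : Continuous (i.2.1 : SplittingAt V (repAt a₀ i.1))), HasWeight (L : Type) (μ i hi hg) 1)
      (σ : ∀ (i : I V (repAt a₀) (muLiu ι₁ GramClass.rep)) (hi : PhiMu i) (hg : Continuous (i.2.1 : SplittingAt V (repAt a₀ i.1))),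
        {χ : (line V (repAt a₀) (muLiu ι₁ GramClass.rep) i).CharW // (line V (repAt a₀) (muLiu ι₁ GramClass.rep) i).IsAutChar χ} →
          (toThm418Data _ (R i hi hg (μ i hi hg) (hμ i hi hg) (hw i hi hg))).AdmIndex)
      (e : ∀ (i : I V (repAt a₀) (muLiu ι₁ GramClass.rep)) (hi : PhiMu i) (hg : Continuous (i.2.1 : SplittingAt V (repAt a₀ i.1)))
        (a : {χ : (line V (repAt a₀) (muLiu ι₁ GramClass.rep) i).CharW //
          (line V (repAt a₀) (muLiu ι₁ GramClass.rep) i).IsAutChar χ}),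
        (line V (repAt a₀) (muLiu ι₁ GramClass.rep) i).Ω ιV a.1 ≃ₗ[ℂ]
          (toThm418Data _ (R i hi hg (μ i hi hg) (hμ i hi hg) (hw i hi hg))).omegaAt (σ i hi hg a)),
      (∀ (i : I V (repAt a₀) (muLiu ι₁ GramClass.rep)) (hi : PhiMu i) (hg : Continuous (i.2.1 : SplittingAt V (repAt a₀ i.1))),
          HasCMType (L : Type) (μ i hi hg) (line V (repAt a₀) (muLiu ι₁ GramClass.rep) i).lineType) ∧
      (∀ (i : I V (repAt a₀) (muLiu ι₁ GramClass.rep)) (hi : PhiMu i) (hg : Continuous (i.2.1 : SplittingAt V (repAt a₀ i.1))),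
          Function.Injective (σ i hi hg)) ∧
      (∀ (i : I V (repAt a₀) (muLiu ι₁ GramClass.rep)) (hi : PhiMu i) (hg : Continuous (i.2.1 : SplittingAt V (repAt a₀ i.1)))
          (a : {χ : (line V (repAt a₀) (muLiu ι₁ GramClass.rep) i).CharW //
            (line V (repAt a₀) (muLiu ι₁ GramClass.rep) i).IsAutChar χ})
          (g : ↥V.adelicFin) (m : (line V (repAt a₀) (muLiu ι₁ GramClass.rep) i).Ω ιV a.1),
          e i hi hg a (MonoidAlgebra.of ℂ ↥V.adelicFin g • m) =
            (toThm418Data _ (R i hi hg (μ i hi hg) (hμ i hi hg) (hw i hi hg))).rhoAt (σ i hi hg a) g (e i hi hg a m)) :=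
  exists_pinTerms_update_tail V (repAt a₀) (muLiu ι₁ GramClass.rep) ιV h Φ PhiMu
    (fun i => Continuous (i.2.1 : SplittingAt V (repAt a₀ i.1))) (fun i _ hg => key_indexOfRecord_noCut V a₀ hemb i hg) t R hR

end OfRecord

end HodgeCM.Model.LiuIndex.OmegaPin

end
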